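import Literature.Computability.ImplicitComplexity.STAPolystep
import Literature.Computability.ImplicitComplexity.STATokenSubst
import Literature.Computability.Complexity.PlumbingBricks
import Literature.Computability.Complexity.LengthCompare
import Literature.Computability.Complexity.Classes
import HarnessLib

/-!
# `STA` is sound for `PTIME`: soft-representable languages are in `P` (GMR08 Thm. 3.5)

Support file for `STACapturesP` (`SoftTypeAssignmentPTIME.lean`): the **soundness half**,
unconditionally. GMR08 Theorem 3.5: "every typing of `M` is an upper bound of its reduction
complexity. Since every β-reduction step can be carried out on a Turing machine in a number of
steps polynomial in the size of the term, we have the soundness with respect to PTIME." With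
Def. 3.8 (a language is decided by `⊢ M : !ⁿ S_m ⊸ B` through `s ∈ L ⟺ M s̲ →β* 0`):

* `SoftRepresentsAtLevel.mem_classesP` — **if `L ⊆ {0,1}*` is soft-representable at some level
  then `L ∈ P`** (the tree's `Classes.P`, Mathlib `FinTM2` deciders).

The deciding function: on input `s`, write the prefix code of `M s̲` (`codeFP_initToks`), iterate
the leftmost-outermost β-step on codes (`codeFP_loStepToks`) `C(|s|+1)^{t+1} + 1` times — one more
than the bound of `weight_program`/`polystep_program` on the length of ANY reduction sequence, so
that the iterate is the normal form (`Term.loStep_clocked`), every iterate being a typed closed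
reduct of polynomial size (`mtyping_iterate_loStep`, hence a polynomially long code,
`length_rawE_pre_le`) — and compare with the code of `0` (normal forms of sum-free terms are
unique, `reduces_zero_iff_loStep_clocked`). All of it is one `FP` function by the `CodeFP`
combinators, and `mem_P_of_mem_FP` concludes.

## References

* [GaboardiMarionRonchidellarocca2008] GMR08, Thm. 3.5, Def. 3.8 (and Lemma 3.3, 3.4).
* S. Arora, B. Barak, Computational Complexity: A Modern Approach, CUP 2009, §1.3 [AroraBarak2009].
-/

namespace Literature.Computability.ImplicitComplexity

namespace STA

open Literature.Computability.Complexity Literature.Computability.Complexity.CodeFP Polynomial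

/-! ### Typed closed reducts: sizes and variable indices -/

/-- **The leftmost-outermost iterates of a typed term are typed, with no larger weight.**
[cite: GaboardiMarionRonchidellarocca2008, Lemma 3.4] -/
theorem mtyping_iterate_loStep {r d w : ℕ} {Γ : Ctx} {M : Term} {σ : SoftTy}
    (h : MTyping r w d Γ M σ) (hr : 1 ≤ r) (n : ℕ) :
    ∃ d' w', w' ≤ w ∧ MTyping r w' d' Γ (Term.loStep^[n] M) σ := by
  induction n with
  | zero => exact ⟨d, w, le_rfl, h⟩
  | succ n ih =>
    obtain ⟨d', w', hw', hder⟩ := ih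
    rw [Function.iterate_succ_apply']
    by_cases hred : (Term.loStep^[n] M).hasRedex = true
    · obtain ⟨d'', w'', -, hw'', hder'⟩ := hder.subject_reduction hr (Term.red_loStep hred)
      exact ⟨d'', w'', by omega, hder'⟩
    · rw [Term.loStep_of_hasRedex_false (by simpa using hred)]
      exact ⟨d', w', hw', hder⟩

/-- **Variable indices of a term closed below `c` are bounded by `c` plus the size** (an index is
smaller than the number of enclosing binders plus `c`). [folklore] -/
theorem idx_lt_of_freeIn_lt : ∀ (N : Term) (c : ℕ), (∀ i, N.FreeIn i → i < c) →
    ∀ tk ∈ N.pre, tk.idx < c + N.size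
  | .var k, c, h, tk, htk => by
    simp only [Term.pre, List.mem_singleton] at htk
    subst htk
    have := h k rfl
    simp [Tok.idx, Term.size]; omega
  | .lam M, c, h, tk, htk => by
    simp only [Term.pre, List.mem_cons] at htk
    rcases htk with rfl | htk
    · have := Term.size_pos (Term.lam M); simp only [Tok.idx]; omega
    · have h' : ∀ i, M.FreeIn i → i < c + 1 := fun i hi => by
        cases i with
        | zero => omega
        | succ i => have := h i hi; omega
      have := idx_lt_of_freeIn_lt M (c + 1) h' tk htk
      simp only [Term.size]; omega
  | .app M N, c, h, tk, htk => by
    simp only [Term.pre, List.mem_cons, List.mem_append] at htk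
    rcases htk with rfl | htk | htk
    · have := Term.size_pos (Term.app M N); simp only [Tok.idx]; omega
    · have := idx_lt_of_freeIn_lt M c (fun i hi => h i (Or.inl hi)) tk htk
      simp only [Term.size]; omega
    · have := idx_lt_of_freeIn_lt N c (fun i hi => h i (Or.inr hi)) tk htk
      simp only [Term.size]; omega
  | .sum M N, c, h, tk, htk => by
    simp only [Term.pre, List.mem_cons, List.mem_append] at htk
    rcases htk with rfl | htk | htk
    · have := Term.size_pos (Term.sum M N); simp only [Tok.idx]; omega
    · have := idx_lt_of_freeIn_lt M c (fun i hi => h i (Or.inl hi)) tk htk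
      simp only [Term.size]; omega
    · have := idx_lt_of_freeIn_lt N c (fun i hi => h i (Or.inr hi)) tk htk
      simp only [Term.size]; omega

/-- **The code of a closed term of size `≤ B` has length `≤ B (2B + 18)`.** [folklore] -/
theorem length_rawE_pre_le {N : Term} {B : ℕ} (hclosed : ∀ i, ¬N.FreeIn i) (hB : N.size ≤ B) :
    (rawE tokE N.pre).length ≤ B * (2 * B + 18) := by
  have hidx : ∀ tk ∈ N.pre, tk.idx < N.size := fun tk htk => by
    have := idx_lt_of_freeIn_lt N 0 (fun i hi => absurd hi (hclosed i)) tk htk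
    omega
  rw [length_rawE]
  calc (N.pre.map fun a => 2 * (tokE a).length + 2).sum
      ≤ (N.pre.map fun a => 2 * (tokE a).length + 2).length • (2 * B + 18) :=
        List.sum_le_card_nsmul _ _ fun x hx => by
          obtain ⟨tk, htk, rfl⟩ := List.mem_map.1 hx
          have h1 := length_tokE_le tk
          have h2 := hidx tk htk
          omega
    _ ≤ B * (2 * B + 18) := by
        rw [List.length_map, smul_eq_mul, Term.length_pre]
        exact Nat.mul_le_mul_right _ hB

/-! ### The code of the applied program -/

/-- The six tokens coding one letter inside `s̲`. [folklore] -/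
def bitChunk (b : Bool) : List Tok := [.A, .A, .V 1, .L, .L, .V (if b then 0 else 1)]

/-- The code of the body of a word. [folklore] -/
theorem pre_wordBody (s : List Bool) :
    (s.foldr (fun b acc => Term.app (.app (.var 1) (STA.encBit b)) acc) (.var 0)).pre =
      (s.map bitChunk).flatten ++ [.V 0] := by
  induction s with
  | nil => rfl
  | cons b s ih =>
    rw [List.foldr_cons, Term.pre, Term.pre, ih]
    cases b <;> rfl

/-- **The code of `M s̲`.** [folklore] -/
theorem pre_app_encWord (M : Term) (s : List Bool) :
    (Term.app M (encWord s)).pre = [.A] ++ M.pre ++ [.L, .L] ++ (s.map bitChunk).flatten ++ [.V 0] := by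
  rw [Term.pre, encWord, Term.pre, Term.pre, pre_wordBody]
  simp

/-- Cutting a string into blocks of one bit lists its bits. [folklore] -/
theorem chunks_one (w : List Bool) :
    (List.range w.length).map (fun i => (w.drop (i * 1)).take 1) = w.map fun b => [b] := by
  refine List.ext_getElem (by simp) fun i h₁ h₂ => ?_
  simp only [List.length_map, List.length_range] at h₁
  simp only [List.getElem_map, List.getElem_range, Nat.mul_one]
  rw [List.drop_eq_getElem_cons h₁, List.take_succ_cons, List.take_zero]

/-- The bits of a string as a raw list of bits. [folklore] -/
theorem codeFP_bits : CodeFP strE (rawE bitE) (fun w => w) := by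
  have h : CodeFP strE (rawE strE) (fun w => w.map fun b => [b]) :=
    (strChunks.comp (strLength.pair ((const strE (eβ := unE) 1).pair (CodeFP.id strE)))).congr fun w => by
      simp only [id]
      exact chunks_one w
  exact h.recodeOut fun w => by
    show encList (List.map strE (List.map (fun b => [b]) w)) = encList (List.map bitE w)
    rw [List.map_map]
    rfl

/-- One letter chunk is computed on codes. [folklore] -/
theorem codeFP_bitChunk : CodeFP bitE (rawE tokE) bitChunk :=
  (ite (p := fun b => b) (CodeFP.id bitE) (const bitE (bitChunk true)) (const bitE (bitChunk false))).congr
    fun b => by cases b <;> rfl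

/-- **The code of `M s̲` is computed from `s` in polynomial time.** [folklore] -/
theorem codeFP_initToks (M : Term) : CodeFP strE (rawE tokE) (fun s => (Term.app M (encWord s)).pre) := by
  have hfl : CodeFP strE (rawE tokE) (fun s => (s.map bitChunk).flatten) :=
    (flatten tokE).comp ((map₀ codeFP_bitChunk).comp codeFP_bits)
  have h : CodeFP strE (rawE tokE) (fun s => ([.A] ++ M.pre ++ [.L, .L]) ++ (s.map bitChunk).flatten ++ [.V 0]) :=
    (rawAppend tokE).comp (((rawAppend tokE).comp ((const strE _).pair hfl)).pair (const strE [Tok.V 0]))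
  exact h.congr fun s => by rw [pre_app_encWord]

/-! ### Clocked iteration of the step on codes -/

/-- A left fold over `replicate T ()` is an iteration. [folklore] -/
theorem foldl_replicate_iterate {β : Type} (f : β → β) (T : ℕ) (b : β) :
    (List.replicate T ()).foldl (fun b _ => f b) b = f^[T] b := by
  induction T generalizing b with
  | zero => rfl
  | succ T ih => rw [List.replicate_succ, List.foldl_cons, ih, Function.iterate_succ_apply]

/-- A fixed polynomial of the input length, in unary. [folklore] -/
theorem codeFP_unPolyLength (Q : Polynomial ℕ) : CodeFP strE unE (fun s => Q.eval s.length) :=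
  of_fn (Plumb.polyFn Q) (Plumb.polyFn_mem_FP Q) fun s => by simp [unE_eq_ones]

/-! ### The theorem -/

/-- **`STA` is sound for `PTIME` (GMR08 Theorem 3.5 with Def. 3.8), unconditionally**: a language
`L ⊆ {0,1}*` soft-representable at some level `t` — decided, through `s ∈ L ⟺ M s̲ →β* 0`, by a
closed sum-free `STA` program `⊢ M : !ⁿ S_m ⊸ B` of level `max d(Π) n ≤ t` — is decidable in
deterministic polynomial time: `L ∈ P`. This discharges the `→` half of the fact `STACapturesP`
(`STACapturesP.mem_P` without its hypothesis). [cite: GaboardiMarionRonchidellarocca2008, Thm. 3.5 and Def. 3.8] -/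
theorem _root_.Literature.Computability.ImplicitComplexity.SoftRepresentsAtLevel.mem_classesP
    {t : ℕ} {L : Language Bool} (h : SoftRepresentsAtLevel t L) :
    L ∈ Literature.Computability.Complexity.Classes.P := by
  classical
  obtain ⟨M, d, n, m, hM, hd, hn, hm, hT, hL⟩ := h
  obtain ⟨K, hC⟩ := weight_program hM hd hn hm hT
  -- the clock and the size bound
  set W : List Bool → ℕ := fun s => K * (s.length + 1) ^ (t + 1) with hW
  have hsf : ∀ s, (Term.app M (encWord s)).SumFree := fun s => by
    obtain ⟨r, d', w, -, happ, -⟩ := hC s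
    exact happ.sumFree
  have hiter : ∀ s k, (Term.loStep^[k] (.app M (encWord s))).size ≤ W s ∧
      ∀ i, ¬(Term.loStep^[k] (.app M (encWord s))).FreeIn i := by
    intro s k
    obtain ⟨r, d', w, hr, happ, hw⟩ := hC s
    obtain ⟨d'', w'', hw'', hder⟩ := mtyping_iterate_loStep happ hr k
    exact ⟨(hder.size_le hr).trans (hw''.trans hw), fun i hi => hder.isSome_of_freeIn hi rfl⟩
  have hbound : ∀ s (f : ℕ → Term) (Lf : ℕ), f 0 = .app M (encWord s) →
      (∀ i, i < Lf → Red (f i) (f (i + 1))) → Lf ≤ W s := by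
    intro s f Lf h0 hstep
    obtain ⟨r, d', w, hr, happ, hw⟩ := hC s
    exact (happ.redSeq_bound hr f Lf h0 hstep).1.trans hw
  -- the deciding map on the term side
  set dec : List Bool → Bool := fun s =>
    decide ((List.replicate (W s + 1) ()).foldl (fun ts _ => loStepToks ts) (Term.app M (encWord s)).pre =
      STA.zero.pre) with hdec
  have hdec_spec : ∀ s, dec s = decide (s ∈ L) := by
    intro s
    simp only [hdec, foldl_replicate_iterate, loStepToks_iterate_pre]
    have hclock := Term.reduces_zero_iff_loStep_clocked (hsf s) (W := W s) (hbound s) (T := W s + 1) (by omega)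
    have hLs : s ∈ L ↔ Reduces (.app M (encWord s)) STA.zero := hL s
    by_cases hs : s ∈ L
    · rw [decide_eq_true hs, decide_eq_true]
      rw [(hclock.1 (hLs.1 hs))]
    · rw [decide_eq_false hs, decide_eq_false]
      intro he
      exact hs (hLs.2 (hclock.2 (pre_injective he)))
  -- the deciding map is computed on codes
  have hfold : CodeFP (pairE strE (rawE unitE)) (rawE tokE)
      (fun p => p.2.foldl (fun ts _ => loStepToks ts) (Term.app M (encWord p.1)).pre) := by
    refine foldl (σ := List Bool) (eσ := strE) (α := Unit) (eα := unitE) (β := List Tok) (eβ := rawE tokE)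
      (step := fun _ _ ts => loStepToks ts) (init := fun s => (Term.app M (encWord s)).pre)
      (codeFP_loStepToks.comp (snd _ _).snd') (codeFP_initToks M)
      (C (K * (2 * K + 18)) * (X + 1) ^ (2 * (t + 1))) fun s l₁ l₂ => ?_
    -- every iterate is a closed reduct of size `≤ W s`, `W s ≤ C (n+1)^{t+1}` for the input length `n`
    have hit : l₁.foldl (fun ts (_ : Unit) => loStepToks ts) (Term.app M (encWord s)).pre =
        (Term.loStep^[l₁.length] (.app M (encWord s))).pre := by
      rw [← loStepToks_iterate_pre, ← foldl_replicate_iterate loStepToks l₁.length]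
      rw [show l₁ = List.replicate l₁.length () from List.eq_replicate_iff.2 ⟨rfl, fun u _ => by cases u; rfl⟩]
      simp
    rw [hit]
    obtain ⟨hsz, hcl⟩ := hiter s l₁.length
    refine (length_rawE_pre_le hcl hsz).trans ?_
    set nn := (pairE strE (rawE unitE) (s, l₁ ++ l₂)).length with hnn
    have hsn : s.length ≤ nn := by rw [hnn, pairE_apply, length_boolPair]; simp; omega
    have hWle : W s ≤ K * (nn + 1) ^ (t + 1) := by
      simp only [hW]
      exact Nat.mul_le_mul_left _ (Nat.pow_le_pow_left (by omega) _)
    have heval : (C (K * (2 * K + 18)) * (X + 1) ^ (2 * (t + 1)) : Polynomial ℕ).eval nn =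
        K * (2 * K + 18) * (nn + 1) ^ (2 * (t + 1)) := by
      simp [eval_mul, eval_pow]
    rw [heval]
    have hp : (nn + 1) ^ (2 * (t + 1)) = (nn + 1) ^ (t + 1) * (nn + 1) ^ (t + 1) := by
      rw [two_mul, pow_add]
    have h1 : 1 ≤ (nn + 1) ^ (t + 1) := Nat.one_le_pow _ _ (by omega)
    calc W s * (2 * W s + 18)
        ≤ (K * (nn + 1) ^ (t + 1)) * (2 * (K * (nn + 1) ^ (t + 1)) + 18 * (nn + 1) ^ (t + 1)) :=
          Nat.mul_le_mul hWle (by nlinarith [hWle, h1])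
      _ = K * (2 * K + 18) * (nn + 1) ^ (2 * (t + 1)) := by rw [hp]; ring
  have hdecFP : CodeFP strE bitE dec := by
    have hT : CodeFP strE (rawE unitE) (fun s => List.replicate (W s + 1) ()) :=
      (replicateUnit.comp (codeFP_unPolyLength (C K * (X + 1) ^ (t + 1) + 1))).congr fun s => by
        simp [hW]
    have hres : CodeFP strE (rawE tokE)
        (fun s => (List.replicate (W s + 1) ()).foldl (fun ts _ => loStepToks ts) (Term.app M (encWord s)).pre) :=
      hfold.comp ((CodeFP.id strE).pair hT)
    exact (CodeFP.eq (rawE_injective tokE_injective)).comp (hres.pair (const strE STA.zero.pre))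
  -- conclude
  obtain ⟨g, hg, hgs⟩ := hdecFP
  refine mem_P_of_mem_FP hg L fun s => ⟨fun hs => ?_, fun hs => ?_⟩
  · have := hgs s
    rw [hdec_spec s, decide_eq_true hs] at this
    exact this
  · have := hgs s
    rw [hdec_spec s, decide_eq_false hs] at this
    exact this

end STA

end Literature.Computability.ImplicitComplexity
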